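import Literature.Geometry.Riemannian.RicciPinchingMinimum
import Literature.Geometry.Lorentzian.CoordRayleighSup
import Literature.Geometry.Riemannian.ThreeShrinkerCompactReduction
import HarnessLib

/-!
# The top Ricci eigenvalue `Λ(y) = sup_{w ≠ 0} Ric_y(w,w)/|w|²` on a Riemannian manifold

For a Riemannian `C^∞` metric `g` on a manifold `M` (model space `E` of positive dimension) the
function

  `Λ(y) := sup_{w ≠ 0} Ric_y(w,w) / g_y(w,w)`,

the top eigenvalue of the Ricci tensor at `y` relative to `g_y` (the quantity `λ_max(Ric)` of the
elliptic Hamilton–Ivey estimate, Hamilton 1995, §24), satisfies (`ricciSup_spec`):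

* `Λ` is continuous on `M`;
* `Ric_y(w,w) ≤ Λ(y) g_y(w,w)` for every `w ∈ T_yM`;
* `Λ(y)` is the least such constant: if `Ric_y ≤ c g_y` then `Λ(y) ≤ c`.

The proof transports the chart-level statements of
`Literature/Geometry/Lorentzian/CoordRayleighSup.lean` (`MetricCoord.continuousOn_rayleighSup`,
`MetricCoord.isCompact_rayleighQuot_image_sphere`) along the inverse extended chart: read in the
chart at `x₀` (O'Neill 1983, Ch. 3, Prop. 3.59), `Ric` and `g` are the coordinate objects
`MetricCoord.ricAt G`, `G` of the chart components `G` (`ricci_chartInv_mfderiv_eq_ricAt`,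
`val_chartInv_mfderiv_eq_chartRep`), and the differential of the inverse chart is a linear
isomorphism of the fibres, so the sets of values of the quotient agree
(`rayleighQuot_image_chartInv_eq`). This is the `sup` companion of
`Literature/Geometry/Riemannian/RicciPinchingMinimum.lean`.

The bottom eigenvalue `λ(y) := inf_{w ≠ 0} Ric_y(w,w) / g_y(w,w)` (the quantity minimised against a
barrier in the potential in step 1 of the proof of Munteanu–Wang 2017, Thm. 2) satisfies the mirror
statements (`ricciInf_spec`): `λ` is continuous, `λ(y) g_y(w,w) ≤ Ric_y(w,w)`, and `c ≤ λ(y)`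
whenever `c g_y ≤ Ric_y`; at chart level `inf B/G = -sup (-B)/G` (`continuousOn_rayleighInf`).

Everything is proved; no definitions are introduced.

## References

* B. O'Neill, *Semi-Riemannian geometry*, Academic Press 1983, Ch. 3, Prop. 3.59 (tensors read in
  charts). [ONeill1983]
* R. S. Hamilton, *The formation of singularities in the Ricci flow*, Surveys in Differential
  Geometry II (1995), §24 (the Hamilton–Ivey pinching estimate). [Hamilton1995]
* O. Munteanu, J. Wang, *Positively curved shrinking Ricci solitons are compact*, J. Differential
  Geom. 106 (2017), Thm. 2 (step 1 of the proof: the bottom Ricci eigenvalue). [MunteanuWang2017]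
-/

noncomputable section

set_option maxSynthPendingDepth 3

open Bundle Set Function Filter Module Metric
open scoped Manifold ContDiff Topology

namespace Literature.Geometry.Riemannian

open Lorentzian Lorentzian.PseudoRiemannianMetric

variable {E : Type*} [NormedAddCommGroup E] [NormedSpace ℝ E] [FiniteDimensional ℝ E]
  {H : Type*} [TopologicalSpace H] {I : ModelWithCorners ℝ E H} [I.Boundaryless]
  {M : Type*} [TopologicalSpace M] [ChartedSpace H M] [IsManifold I ∞ M]
  (g : PseudoRiemannianMetric I ∞ E (TangentSpace I : M → Type _)) [g.HasLeviCivita]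

/-! ### The Rayleigh quotient `Ric(w,w)/|w|²` read in a chart -/

/-- **The quotient `Ric(w,w)/g(w,w)` read in the chart**: for `u` in the chart target at `x₀`,
`x = Φ(u)` and `w = dΦ_u ŵ`, it equals `ricAt G u (ŵ,ŵ) / G u (ŵ,ŵ)` for the chart components
`G`. [cite: ONeill1983, Ch. 3, Prop. 3.59] -/
theorem rayleighQuot_chartInv_eq (x₀ : M) (u : chartTarget I x₀) (w : E) :
    g.ricci (chartInv I x₀ u) (mfderiv 𝓘(ℝ, E) I (chartInv I x₀) u w)
        (mfderiv 𝓘(ℝ, E) I (chartInv I x₀) u w) /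
      g.val (chartInv I x₀ u) (mfderiv 𝓘(ℝ, E) I (chartInv I x₀) u w)
        (mfderiv 𝓘(ℝ, E) I (chartInv I x₀) u w) =
    MetricCoord.ricAt (chartRep I (fun _ ↦ g) x₀ 0) u w w / chartRep I (fun _ ↦ g) x₀ 0 u w w := by
  rw [ricci_chartInv_mfderiv_eq_ricAt, val_chartInv_mfderiv_eq_chartRep]

/-- The set of values of `Ric(w,w)/g(w,w)` over non-zero tangent vectors at `Φ(u)` is the set of
values of the chart quotient over non-zero model vectors (`dΦ_u` is a linear isomorphism).
[folklore] -/
theorem rayleighQuot_image_chartInv_eq (x₀ : M) (u : chartTarget I x₀) :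
    (fun w : TangentSpace I (chartInv I x₀ u) ↦ g.ricci (chartInv I x₀ u) w w /
        g.val (chartInv I x₀ u) w w) '' {w | w ≠ 0} =
      (fun w : E ↦ MetricCoord.ricAt (chartRep I (fun _ ↦ g) x₀ 0) u w w /
        chartRep I (fun _ ↦ g) x₀ 0 u w w) '' {w | w ≠ 0} := by
  have hinj := injective_mfderiv_chartInv (I := I) x₀ u
  have hinv := isInvertible_mfderiv_of_injective rfl hinj
  set L := mfderiv 𝓘(ℝ, E) I (chartInv I x₀) u with hL
  ext r
  constructor
  · rintro ⟨w, hw, rfl⟩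
    obtain ⟨v, rfl⟩ : ∃ v : E, L v = w :=
      ⟨L.inverse w, by rw [← ContinuousLinearMap.comp_apply, hinv.self_comp_inverse]; rfl⟩
    refine ⟨v, fun hv ↦ hw (by subst hv; exact map_zero L), ?_⟩
    exact (rayleighQuot_chartInv_eq g x₀ u v).symm
  · rintro ⟨v, hv, rfl⟩
    refine ⟨L v, fun h0 ↦ hv (hinj (h0.trans (map_zero L).symm)), ?_⟩
    exact rayleighQuot_chartInv_eq g x₀ u v

/-! ### The top Ricci eigenvalue -/

/-- **The top Ricci eigenvalue** `Λ(y) = sup_{w ≠ 0} Ric_y(w,w)/g_y(w,w)` of a Riemannian `C^∞`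
metric (model space of positive dimension): `Λ` is continuous on `M`, `Ric_y(w,w) ≤ Λ(y) g_y(w,w)`
for every `w`, and `Λ(y) ≤ c` whenever `Ric_y ≤ c g_y` (the `λ_max(Ric)` of the Hamilton–Ivey
estimate, Hamilton 1995, §24; continuity by reading the supremum over the compact unit sphere of
the chart, O'Neill 1983, Ch. 3, Prop. 3.59). [folklore] -/
theorem ricciSup_spec (hg : g.IsRiemannian) (hE : 0 < finrank ℝ E) :
    (Continuous fun y : M ↦
        sSup ((fun w : TangentSpace I y ↦ g.ricci y w w / g.val y w w) '' {w | w ≠ 0})) ∧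
      (∀ (y : M) (w : TangentSpace I y), g.ricci y w w ≤
        sSup ((fun w : TangentSpace I y ↦ g.ricci y w w / g.val y w w) '' {w | w ≠ 0})
          * g.val y w w) ∧
      (∀ (y : M) (c : ℝ), (∀ w : TangentSpace I y, g.ricci y w w ≤ c * g.val y w w) →
        sSup ((fun w : TangentSpace I y ↦ g.ricci y w w / g.val y w w) '' {w | w ≠ 0}) ≤ c) := by
  haveI : Nontrivial E := Module.finrank_pos_iff.mp hE
  -- the fibre supremum
  set ψ : M → ℝ := fun y ↦ sSup ((fun w : TangentSpace I y ↦ g.ricci y w w / g.val y w w) ''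
    {w | w ≠ 0}) with hψ
  -- chart data at a point
  have hchart : ∀ x₀ : M,
      let G := chartRep I (fun _ ↦ g) x₀ 0
      MetricCoord.IsMetricOn G (extChartAt I x₀).target ∧
        (∀ y ∈ (extChartAt I x₀).target, ∀ w : E, w ≠ 0 → 0 < G y w w) := by
    intro x₀ G
    refine ⟨Lorentzian.OpensChart.isMetricOn_repr
      (val_chartPullback_eq_chartRep (fun _ : ℝ ↦ g) x₀ 0), fun y hy w hw ↦ ?_⟩
    rw [show y = ((⟨y, hy⟩ : chartTarget I x₀) : E) from rfl, chartRep_apply]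
    exact chartPullback_pos g x₀ ⟨y, hy⟩ (fun w' hw' ↦ hg _ w' hw') w hw
  -- `ψ` read in the chart at `x₀`: `ψ x = Λ̂(φ x)` on the chart source
  have hψchart : ∀ (x₀ x : M), x ∈ (extChartAt I x₀).source →
      ψ x = sSup ((fun w : E ↦ MetricCoord.ricAt (chartRep I (fun _ ↦ g) x₀ 0)
        (extChartAt I x₀ x) w w / chartRep I (fun _ ↦ g) x₀ 0 (extChartAt I x₀ x) w w) ''
          {w | w ≠ 0}) := by
    intro x₀ x hx
    have hu : extChartAt I x₀ x ∈ (extChartAt I x₀).target := (extChartAt I x₀).map_source hx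
    set u : chartTarget I x₀ := ⟨extChartAt I x₀ x, hu⟩
    have hxu : chartInv I x₀ u = x := (extChartAt I x₀).left_inv hx
    rw [show (extChartAt I x₀ x) = (u : E) from rfl, ← rayleighQuot_image_chartInv_eq g x₀ u]
    simp only [hψ]
    rw [hxu]
  refine ⟨?_, fun y w ↦ ?_, fun y c hc ↦ ?_⟩
  · -- continuity of `ψ`
    rw [continuous_iff_continuousAt]
    intro x₀
    obtain ⟨hGm, hpos⟩ := hchart x₀
    have hΛ := MetricCoord.continuousOn_rayleighSup (isOpen_extChartAt_target x₀)
      hGm.contDiffOn_ricAt.continuousOn hGm.contDiffOn.continuousOn hpos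
    have hev : ψ =ᶠ[𝓝 x₀] fun x ↦ sSup ((fun w : E ↦
        MetricCoord.ricAt (chartRep I (fun _ ↦ g) x₀ 0) (extChartAt I x₀ x) w w /
          chartRep I (fun _ ↦ g) x₀ 0 (extChartAt I x₀ x) w w) '' {w | w ≠ 0}) := by
      filter_upwards [extChartAt_source_mem_nhds (I := I) x₀] with x hx using hψchart x₀ x hx
    refine ContinuousAt.congr ?_ hev.symm
    exact (hΛ.continuousAt ((isOpen_extChartAt_target x₀).mem_nhds
      (mem_extChartAt_target x₀))).comp (continuousAt_extChartAt x₀)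
  · -- `Ric(w,w) ≤ Λ |w|²`
    by_cases hw : w = 0
    · subst hw; simp
    · obtain ⟨hGm, hpos⟩ := hchart y
      have hu : extChartAt I y y ∈ (extChartAt I y).target := mem_extChartAt_target y
      have hle : g.ricci y w w / g.val y w w ≤ ψ y := by
        have hmem : g.ricci y w w / g.val y w w ∈
            (fun w : TangentSpace I y ↦ g.ricci y w w / g.val y w w) '' {w | w ≠ 0} :=
          ⟨w, hw, rfl⟩
        have hbdd : BddAbove ((fun w : TangentSpace I y ↦ g.ricci y w w / g.val y w w) ''
            {w | w ≠ 0}) := by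
          set u : chartTarget I y := ⟨extChartAt I y y, hu⟩
          have hxu : chartInv I y u = y := extChartAt_to_inv y
          have himg := rayleighQuot_image_chartInv_eq g y u
          rw [hxu] at himg
          rw [himg, MetricCoord.rayleighQuot_image_ne_zero_eq_image_sphere]
          exact (MetricCoord.isCompact_rayleighQuot_image_sphere (hpos _ hu)).bddAbove
        exact le_csSup hbdd hmem
      change g.ricci y w w ≤ ψ y * g.val y w w
      rwa [div_le_iff₀ (hg y w hw)] at hle
  · -- leastness
    change ψ y ≤ c
    obtain ⟨w₁, hw₁⟩ := (Module.finrank_pos_iff_exists_ne_zero (R := ℝ) (M := E)).mp hE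
    have hne : ((fun w : TangentSpace I y ↦ g.ricci y w w / g.val y w w) ''
        {w | w ≠ 0}).Nonempty :=
      Set.Nonempty.image _ ⟨(w₁ : TangentSpace I y), hw₁⟩
    refine csSup_le hne ?_
    rintro r ⟨w, hw, rfl⟩
    exact (div_le_iff₀ (hg y w hw)).mpr (hc w)

/-! ### The bottom Ricci eigenvalue -/

/-- **Continuity of the bottom Rayleigh quotient** (chart level)
`y ↦ λ_min(y) = inf_{w ≠ 0} B_y(w,w)/G_y(w,w)` on an open set `T` on which the fields of bilinear
forms `B`, `G` are continuous and `G` is positive definite (finite-dimensional model space):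
`inf_{w ≠ 0} B(w,w)/G(w,w) = -sup_{w ≠ 0} (-B)(w,w)/G(w,w)` (`Real.sInf_def`), and the supremum is
continuous by `MetricCoord.continuousOn_rayleighSup` applied to `-B`. [folklore] -/
theorem continuousOn_rayleighInf {B G : E → E →L[ℝ] E →L[ℝ] ℝ} {T : Set E} (hT : IsOpen T)
    (hB : ContinuousOn B T) (hG : ContinuousOn G T) (hpos : ∀ y ∈ T, ∀ w : E, w ≠ 0 → 0 < G y w w)
    [Nontrivial E] :
    ContinuousOn (fun y ↦ sInf ((fun w : E ↦ B y w w / G y w w) '' {w | w ≠ 0})) T := by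
  have h := (MetricCoord.continuousOn_rayleighSup (B := fun y ↦ -B y) hT hB.neg hG hpos).neg
  refine h.congr fun y _ ↦ ?_
  simp only [Real.sInf_def, ← Set.image_neg_eq_neg, Set.image_image, Pi.neg_apply, neg_apply,
    neg_div]

/-- **The bottom Ricci eigenvalue** `λ(y) = inf_{w ≠ 0} Ric_y(w,w)/g_y(w,w)` of a Riemannian
`C^∞` metric (model space of positive dimension): `λ` is continuous on `M`,
`λ(y) g_y(w,w) ≤ Ric_y(w,w)` for every `w`, and `c ≤ λ(y)` whenever `c g_y ≤ Ric_y` (the smallest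
eigenvalue of the Ricci tensor relative to `g`, the quantity minimised against a barrier in `f` in
step 1 of the proof of Munteanu–Wang 2017, Thm. 2; continuity by reading the infimum over the
compact unit sphere of the chart, O'Neill 1983, Ch. 3, Prop. 3.59). The mirror image of
`ricciSup_spec`. [folklore] -/
theorem ricciInf_spec (hg : g.IsRiemannian) (hE : 0 < finrank ℝ E) :
    (Continuous fun y : M ↦
        sInf ((fun w : TangentSpace I y ↦ g.ricci y w w / g.val y w w) '' {w | w ≠ 0})) ∧
      (∀ (y : M) (w : TangentSpace I y),
        sInf ((fun w : TangentSpace I y ↦ g.ricci y w w / g.val y w w) '' {w | w ≠ 0})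
          * g.val y w w ≤ g.ricci y w w) ∧
      (∀ (y : M) (c : ℝ), (∀ w : TangentSpace I y, c * g.val y w w ≤ g.ricci y w w) →
        c ≤ sInf ((fun w : TangentSpace I y ↦ g.ricci y w w / g.val y w w) '' {w | w ≠ 0})) := by
  haveI : Nontrivial E := Module.finrank_pos_iff.mp hE
  -- the fibre infimum
  set ψ : M → ℝ := fun y ↦ sInf ((fun w : TangentSpace I y ↦ g.ricci y w w / g.val y w w) ''
    {w | w ≠ 0}) with hψ
  -- chart data at a point
  have hchart : ∀ x₀ : M,
      let G := chartRep I (fun _ ↦ g) x₀ 0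
      MetricCoord.IsMetricOn G (extChartAt I x₀).target ∧
        (∀ y ∈ (extChartAt I x₀).target, ∀ w : E, w ≠ 0 → 0 < G y w w) := by
    intro x₀ G
    refine ⟨Lorentzian.OpensChart.isMetricOn_repr
      (val_chartPullback_eq_chartRep (fun _ : ℝ ↦ g) x₀ 0), fun y hy w hw ↦ ?_⟩
    rw [show y = ((⟨y, hy⟩ : chartTarget I x₀) : E) from rfl, chartRep_apply]
    exact chartPullback_pos g x₀ ⟨y, hy⟩ (fun w' hw' ↦ hg _ w' hw') w hw
  -- `ψ` read in the chart at `x₀`: `ψ x = λ̂_min(φ x)` on the chart source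
  have hψchart : ∀ (x₀ x : M), x ∈ (extChartAt I x₀).source →
      ψ x = sInf ((fun w : E ↦ MetricCoord.ricAt (chartRep I (fun _ ↦ g) x₀ 0)
        (extChartAt I x₀ x) w w / chartRep I (fun _ ↦ g) x₀ 0 (extChartAt I x₀ x) w w) ''
          {w | w ≠ 0}) := by
    intro x₀ x hx
    have hu : extChartAt I x₀ x ∈ (extChartAt I x₀).target := (extChartAt I x₀).map_source hx
    set u : chartTarget I x₀ := ⟨extChartAt I x₀ x, hu⟩
    have hxu : chartInv I x₀ u = x := (extChartAt I x₀).left_inv hx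
    rw [show (extChartAt I x₀ x) = (u : E) from rfl, ← rayleighQuot_image_chartInv_eq g x₀ u]
    simp only [hψ]
    rw [hxu]
  refine ⟨?_, fun y w ↦ ?_, fun y c hc ↦ ?_⟩
  · -- continuity of `ψ`
    rw [continuous_iff_continuousAt]
    intro x₀
    obtain ⟨hGm, hpos⟩ := hchart x₀
    have hΛ := continuousOn_rayleighInf (isOpen_extChartAt_target x₀)
      hGm.contDiffOn_ricAt.continuousOn hGm.contDiffOn.continuousOn hpos
    have hev : ψ =ᶠ[𝓝 x₀] fun x ↦ sInf ((fun w : E ↦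
        MetricCoord.ricAt (chartRep I (fun _ ↦ g) x₀ 0) (extChartAt I x₀ x) w w /
          chartRep I (fun _ ↦ g) x₀ 0 (extChartAt I x₀ x) w w) '' {w | w ≠ 0}) := by
      filter_upwards [extChartAt_source_mem_nhds (I := I) x₀] with x hx using hψchart x₀ x hx
    refine ContinuousAt.congr ?_ hev.symm
    exact (hΛ.continuousAt ((isOpen_extChartAt_target x₀).mem_nhds
      (mem_extChartAt_target x₀))).comp (continuousAt_extChartAt x₀)
  · -- `λ |w|² ≤ Ric(w,w)`
    by_cases hw : w = 0
    · subst hw; simp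
    · obtain ⟨hGm, hpos⟩ := hchart y
      have hu : extChartAt I y y ∈ (extChartAt I y).target := mem_extChartAt_target y
      have hle : ψ y ≤ g.ricci y w w / g.val y w w := by
        have hmem : g.ricci y w w / g.val y w w ∈
            (fun w : TangentSpace I y ↦ g.ricci y w w / g.val y w w) '' {w | w ≠ 0} :=
          ⟨w, hw, rfl⟩
        have hbdd : BddBelow ((fun w : TangentSpace I y ↦ g.ricci y w w / g.val y w w) ''
            {w | w ≠ 0}) := by
          set u : chartTarget I y := ⟨extChartAt I y y, hu⟩
          have hxu : chartInv I y u = y := extChartAt_to_inv y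
          have himg := rayleighQuot_image_chartInv_eq g y u
          rw [hxu] at himg
          rw [himg, MetricCoord.rayleighQuot_image_ne_zero_eq_image_sphere]
          exact (MetricCoord.isCompact_rayleighQuot_image_sphere (hpos _ hu)).bddBelow
        exact csInf_le hbdd hmem
      change ψ y * g.val y w w ≤ g.ricci y w w
      rwa [le_div_iff₀ (hg y w hw)] at hle
  · -- `λ(y)` is the greatest lower bound
    change c ≤ ψ y
    obtain ⟨w₁, hw₁⟩ := (Module.finrank_pos_iff_exists_ne_zero (R := ℝ) (M := E)).mp hE
    have hne : ((fun w : TangentSpace I y ↦ g.ricci y w w / g.val y w w) ''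
        {w | w ≠ 0}).Nonempty :=
      Set.Nonempty.image _ ⟨(w₁ : TangentSpace I y), hw₁⟩
    refine le_csInf hne ?_
    rintro r ⟨w, hw, rfl⟩
    exact (le_div_iff₀ (hg y w hw)).mpr (hc w)

end Literature.Geometry.Riemannian

end
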